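import Literature.Geometry.Lorentzian.Basic
import Literature.Geometry.Lorentzian.Hypersurface
import Literature.Geometry.Lorentzian.IsometryProofs
import Literature.Geometry.Lorentzian.Volume
import Literature.Geometry.Lorentzian.CauchyDevelopment
import Literature.Geometry.Riemannian.RiemannianDistance
import Literature.Geometry.Riemannian.IsotropicCurvature
import HarnessLib

/-!
# Scale-critical curvature concentration at the end of an incomplete curve
(topic `Geometry/Lorentzian`; definition item `defn-ScaleCriticalConcentrationAt`, wanted by route
`FinalStateConjecture/CurvatureOrSymmetry`, definition request D4, for the crux
`ScaleCriticalUpgrade`)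

The **scale-critical curvature energy** of Klainerman–Rodnianski–Szeftel's bounded `L²` curvature
theorem and the predicate "it concentrates at the ideal end of a curve `γ`" of a space-time.

For a vacuum space-time `(𝓜, 𝐠)` foliated by space-like leaves `Σ_t` with future unit normal `T`,
Klainerman–Rodnianski–Szeftel measure the space-time curvature `𝐑` on a leaf in an orthonormal
frame `e₀ = T, e₁, e₂, e₃` *compatible with the foliation* (arXiv:1204.1767, §3.2: "Let us choose
`e₀ = T`, the future unit normal to the `Σ_t` foliation, and `e_i`, `i = 1, 2, 3` an orthonormal
frame tangent to `Σ_t`", determined up to `ẽ_i = O_i^j e_j`, `O ∈ O(3)`), and control a solution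
by `‖𝐑‖_{L²(Σ_t)}`, `‖∇k‖_{L²(Σ_t)}` (`k` the second fundamental form of the leaves) and the
**volume radius** of the leaves (ibid., Def. 2.1: `r_vol(p, r) = inf_{r' ≤ r} |B_{r'}(p)| / r'³`,
`B_r(p)` the geodesic ball of the leaf; Thm. 2.2 = the main theorem). Under the parabolic
rescaling `𝐠_λ(t, x) = 𝐠(λt, λx)` one has `‖R_λ‖_{L²(B^λ_{r₀})} = √λ ‖R‖_{L²(B_{r₀})}` (ibid.,
§2.3), i.e. the quantity

  `r · ∫_{B_r(x)} |𝐑|²_T dvol`      (`B_r(x)` a geodesic ball of radius `r` in a leaf)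

is **invariant under scaling** — the *scale-critical curvature energy* of the ball — and the
small-data form of the theorem (ibid., Thm. 2.6) says: there is a universal `ε₀ > 0` such that if
on a unit geodesic ball `B ⊆ Σ₀` one has `‖𝐑‖_{L²(B)} ≤ ε`, `‖∇k‖_{L²(B)} ≤ ε`, `ε < ε₀`, and
`r_vol(B, 1) ≥ 1/2`, then the solution is controlled in the domain of dependence of `B` up to time
`1` (by scaling: up to time `∼ r` over a ball of radius `r` with `r ∫_{B_r} |𝐑|² ≤ ε²`). An–Luk
(arXiv:1409.6270, §1) call data that are large only at this level "large merely in a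
scaling-critical norm".

The route `CurvatureOrSymmetry` of the `FinalStateConjecture` summit needs the corresponding
**blow-up notion** at the ideal end of a future-incomplete null geodesic `γ` of a maximal Cauchy
development (its informal crux `ScaleCriticalUpgrade`: parallelly-propagated curvature blow-up
along a visible incomplete ray should upgrade to "`r · ∫_{B_r(x)} |𝐑|² ≥ ε₀` on balls of leaves
shrinking to the end of `γ`", the Step-1 input of blow-up / tangent-profile analyses). This file
supplies it, in the vocabulary of the tree:

* `LorentzianMetric.IsAdaptedFrame g x T f` — `f = (f₁, f₂, f₃)` is a `g`-orthonormal triple of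
  vectors orthogonal to `T` at `x` (with `e₀ = T` a frame compatible with a leaf through `x` with
  unit normal `T`, KRS §3.2);
* `LorentzianMetric.curvNormSqAdapted g x T = |𝐑|²_T(x)` — the sum of the squares of all
  components `𝐑(e_α, e_β, e_γ, e_δ)`, `e = (T, f)`, of the Riemann tensor of `g`
  (`PseudoRiemannianMetric.curvatureForm` of the Levi-Civita connection) in an adapted frame; the
  sum does not depend on the adapted frame (`O(3)`-invariance), and to involve no choice it is
  defined as the supremum over all adapted frames `f`;
* `SpacelikeLeaf g` — a **local space-like leaf**: an injective space-like immersion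
  `φ : U → M` of an open subset `U ⊆ ℝ³` (`IsSpacelikeImmersion`, `Hypersurface.lean`) with a unit
  timelike normal field `ν` (`IsUnitNormal … (-1)`); it carries the induced Riemannian metric
  `h = φ^* g` (`SpacelikeLeaf.metric`), its Riemannian distance balls `SpacelikeLeaf.ball`
  (`PseudoRiemannianMetric.edist`, `RiemannianDistance.lean`), its Riemannian measure
  `SpacelikeLeaf.measure` (`riemannianMeasure`, `Volume.lean`), and the scale-critical energy
  `SpacelikeLeaf.curvatureEnergy L y r = r · ∫⁻_{B_r(y)} |𝐑|²_ν dvol_h` (an extended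
  nonnegative real);
* `SpacelikeLeaf.IsControlled L y Λ v₀` — **unit geometry control at scale `Λ⁻¹` about the centre
  `y`**: the ball `B_{Λ⁻¹}(y)` is relatively compact in the leaf (so that it is an honest geodesic
  ball, not truncated by the edge of the local leaf), `|k|²_h ≤ Λ²` on the leaf (`k` the second
  fundamental form of `φ` w.r.t. `ν`, `secondFundamentalForm`), and the volume radius of the leaf
  at `y` on scales `≤ Λ⁻¹` is at least `v₀`: `|B_ρ(y)| ≥ v₀ ρ³` for `0 < ρ ≤ Λ⁻¹` (KRS, Def. 2.1 and
  the hypotheses `‖k‖ + ‖∇k‖`, `r_vol(Σ₀, 1) ≥ 1/2` of Thm. 2.10);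
* `LorentzianMetric.ScaleCriticalConcentrationAt g γ dom Λ v₀ ε₀` — **scale-critical curvature
  concentration at the (future) end of the curve `γ` with parameter set `dom ⊆ ℝ`**: `0 < ε₀`, and
  for every tail
  `γ({t ∈ dom | t₀ ≤ t})`, every open set `U` containing it and every `δ > 0` there are a leaf `L`
  controlled at scale `Λ⁻¹` about a point `y`, and a radius `0 < r < δ`, such that the ball
  `B_r(y)` is mapped into `U` and `ε₀ ≤ r · ∫_{B_r(y)} |𝐑|²_ν dvol_h`. In words: however small the
  neighbourhood of the end of `γ` and the scale, some admissible leaf carries a geodesic ball of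
  that scale inside the neighbourhood whose scale-critical curvature energy is at least `ε₀` —
  the negation of the smallness hypothesis of KRS, Thm. 2.6, at all scales near the end;
* `CauchyDevelopment.ScaleCriticalConcentrationAt 𝒟 γ dom Λ v₀ ε₀` — the same for the space-time
  of a Cauchy development of `3`-dimensional data, the standing Levi-Civita hypothesis
  `[𝒟.metric.HasLeviCivita]` bound inside as in `CauchyDevelopment.FirstNakedPoint`.

## Design notes

* **Independence of the foliation.** The request asks for a notion "invariant under change of
  foliation with unit geometry control (lapse and second fundamental form bounded)". The energy of
  a ball is a functional of the single leaf carrying it; the predicate quantifies over *all* leaves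
  with unit geometry control (bounded `|k|`, non-collapsed, of at least unit size about the
  centre), so no foliation is chosen and nothing depends on one: every leaf of any local foliation
  with bounded lapse and second fundamental form is admissible, while a lapse bound — a condition
  on how the leaves of a foliation are stacked (`n⁻² = −𝐠(Dt, Dt)`, KRS §3.2) — does not enter the
  energy of one leaf and is therefore not part of `IsControlled`. The negation of the predicate
  reads "on every small ball near the end of every controlled leaf the energy is `< ε₀`", which is
  the hypothesis under which the crux `ScaleCriticalUpgrade` intends to run the KRS continuation
  argument.
* **Why the control is needed at all.** Without it the existential quantifier over leaves could be
  met at a regular point: tilting (boosting) the normal `ν` of ever smaller leaves multiplies the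
  frame components of `𝐑` by unbounded factors. A bound on `|k|_h` over an honest ball of radius
  `Λ⁻¹` ties admissible leaves to the ambient geometry at that scale.
* **Positivity built in.** `0 < ε₀` is a conjunct of the predicate and `0 < Λ`, `0 < v₀` are
  fields of `IsControlled`: for `ε₀ ≤ 0` the inequality `ENNReal.ofReal ε₀ ≤ …` is vacuous, and an
  `∃ ε₀` closure would otherwise be junk-true (compare `HasBoundedGeometryOn.pos`,
  `BoundedGeometry.lean`).
* **Extended reals, lower integrals.** Radii of balls and the energy live in `ℝ≥0∞`
  (`PseudoRiemannianMetric.edist`, `MeasureTheory.lintegral`), so that no integrability or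
  measurability side condition has to be threaded; a ball on which `|𝐑|²_ν` is not integrable has
  infinite energy, consistently with "concentration".
* **No time orientation.** `|𝐑|²_ν`, `|k|²_h` and the induced metric are invariant under
  `ν ↦ −ν`, so the leaf normal is only asked to be unit timelike; for a Cauchy development either
  choice of sign gives the same predicate.
* **Dimension.** Leaves are `3`-dimensional (modelled on `E3 = ℝ³`, as the data manifolds of the
  summit) and the normalisation `r¹` is the critical one for `3 + 1` dimensions; the adapted frames
  are triples, which together with `T` form a basis exactly when `dim M = 4` — the intended case
  (`CauchyDevelopment` of `3`-dimensional data). The ambient model `I` is nevertheless arbitrary,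
  so that the notions apply verbatim to carriers modelled on `𝓡 4`.
* **Junk values.** `curvNormSqAdapted g x T` is a real supremum: `0` if the frame sums were
  unbounded (they are not when `T` is unit timelike and `dim M = 4`: the adapted frames form an
  `O(3)`-orbit on which the sum is constant) and `0` when there is no adapted frame. For `dom = ∅`
  the predicate reduces to `0 < ε₀`; it is meant for the affine domain of a future-incomplete
  geodesic (`0 ∈ dom`, `BddAbove dom` in the route).
* **Imports kept light.** The frame sum `Σ Rm(e_i,e_j,e_k,e_l)²` is
  `PseudoRiemannianMetric.curvNormSqFrame` of `Riemannian/ChangGurskyYangProofs.lean` and geodesic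
  balls / total volume are `PseudoRiemannianMetric.ball` / `riemVolume` of
  `Riemannian/CanonicalNeighbourhoods.lean`; neither file is imported (their import cones carry the
  Ricci-flow library) — the sum is written out and balls are the `edist`-balls of the (Riemannian)
  induced metric directly.
* Mathlib has no Lorentzian geometry, second fundamental form or curvature; in the tree,
  `lean search 'ScaleCritical|volumeRadius|SpacelikeLeaf|IsAdaptedFrame|curvNormSqAdapted|curvatureEnergy'`
  finds only the unrelated Yang–Mills `curvatureEnergy` of `Kaehler/AcceptableBundle.lean`
  (another namespace). Sanity checks run in a scratch file (not shipped): the slice `{t = 0}` of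
  Minkowski space (`Minkowski.sliceEmbed`, `sliceNormal`) is a `SpacelikeLeaf Minkowski.smoothMetric`,
  and Minkowski space has no scale-critical concentration along any curve
  (`not_scaleCriticalConcentrationAt_of_isFlat` with `isFlat_leviCivita_of_val_eq_const`).

## References

* [KlainermanRodnianskiSzeftel2015] S. Klainerman, I. Rodnianski, J. Szeftel, *The bounded `L²`
  curvature conjecture*, Invent. Math. 202 (2015) 91–216 = arXiv:1204.1767 (numbering of the arXiv
  version): Def. 2.1 (volume radius), Thm. 2.2 (main theorem), §2.3 (reduction to small data by
  scaling, `‖R_λ‖_{L²} = √λ ‖R‖_{L²}`), Thm. 2.6 and Thm. 2.10 (small-data versions, universal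
  `ε₀`), §3.2 (frames compatible with the foliation, lapse).
* [AnLuk2017] X. An, J. Luk, *Trapped surfaces in vacuum arising dynamically from mild incoming
  radiation*, Adv. Theor. Math. Phys. 21 (2017) = arXiv:1409.6270, §1 (scaling-critical size of
  data).
-/

noncomputable section

open Bundle Set Filter MeasureTheory Function
open scoped Manifold ContDiff Topology ENNReal

namespace Literature.Geometry.Lorentzian

universe u

variable {E : Type*} [NormedAddCommGroup E] [NormedSpace ℝ E] {H : Type*} [TopologicalSpace H]
  {I : ModelWithCorners ℝ E H} {M : Type*} [TopologicalSpace M] [ChartedSpace H M]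
  [IsManifold I ∞ M]

/-! ### The curvature norm in a frame adapted to a unit timelike vector -/

namespace LorentzianMetric

section AdaptedNorm

variable (g : LorentzianMetric I ∞ M)

/-- The triple `f = (f 0, f 1, f 2)` of tangent vectors at `x` is a **spatial frame adapted to
`T`**: each `f i` is `g`-orthogonal to `T` and the `f i` are `g`-orthonormal
(`PseudoRiemannianMetric.IsOrthonormalFrame`). For `T` the unit normal of a space-like leaf
through `x`, `(T, f 0, f 1, f 2)` is an orthonormal frame *compatible with the leaf* in the sense
of Klainerman–Rodnianski–Szeftel, arXiv:1204.1767, §3.2 ("`e₀ = T` … and `e_i`, `i = 1, 2, 3` an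
orthonormal frame tangent to `Σ_t`"), determined up to `ẽ_i = O_i^j e_j`, `O ∈ O(3)`.
[cite: KlainermanRodnianskiSzeftel2015, §3.2 (compatible frames)] -/
def IsAdaptedFrame (x : M) (T : TangentSpace I x) (f : Fin 3 → TangentSpace I x) : Prop :=
  (∀ i, g.val x T (f i) = 0) ∧ g.IsOrthonormalFrame x f

variable [g.HasLeviCivita]

/-- **The square norm `|𝐑|²_T(x)` of the space-time curvature in a frame adapted to `T`**: the
sum `Σ_{α,β,γ,δ = 0}^{3} 𝐑(e_α, e_β, e_γ, e_δ)²` of the squares of all components of the Riemann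
tensor `𝐑(X, Y, Z, W) = g(R(X, Y)Z, W)` of the Levi-Civita connection of `g`
(`PseudoRiemannianMetric.curvatureForm g g.leviCivita`) in the frame `e = (T, f 0, f 1, f 2)`,
`f` a spatial frame adapted to `T` (`IsAdaptedFrame`). This is the positive-definite norm with
which Klainerman–Rodnianski–Szeftel measure `𝐑` on the leaves `Σ_t` (arXiv:1204.1767, §3.2 with
Thm. 2.2: `‖𝐑‖_{L²(Σ_t)}`; equivalently the norm of `𝐑` for the Riemannian metric
`g + 2 T♭ ⊗ T♭`). The sum is the same for all adapted frames (they differ by `O ∈ O(3)`); so as to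
involve no choice of frame it is defined as the supremum over adapted frames (a real `iSup`: the
junk value `0` if there is no adapted frame or the sums were unbounded, which does not happen for
unit timelike `T` in dimension `4`). The summand is the frame expression
`PseudoRiemannianMetric.curvNormSqFrame` of `Riemannian/ChangGurskyYangProofs.lean` (not imported).
[cite: KlainermanRodnianskiSzeftel2015, §3.2 and Thm. 2.2] -/
def curvNormSqAdapted (x : M) (T : TangentSpace I x) : ℝ :=
  ⨆ f : {f : Fin 3 → TangentSpace I x // g.IsAdaptedFrame x T f},
    ∑ a : Fin 4, ∑ b : Fin 4, ∑ c : Fin 4, ∑ d : Fin 4,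
      g.curvatureForm g.leviCivita x (Matrix.vecCons T f.1 a) (Matrix.vecCons T f.1 b)
        (Matrix.vecCons T f.1 c) (Matrix.vecCons T f.1 d) ^ 2

/-- `|𝐑|²_T(x) ≥ 0` (a supremum of sums of squares; also in the junk cases). [folklore] -/
lemma curvNormSqAdapted_nonneg (x : M) (T : TangentSpace I x) : 0 ≤ g.curvNormSqAdapted x T :=
  Real.iSup_nonneg fun _ ↦ by positivity

/-- For a **flat** metric (`g.leviCivita.IsFlat`: the Riemann tensor vanishes, e.g. Minkowski
space, `Minkowski.riemann_smoothMetric_eq_zero`) the adapted curvature norm vanishes identically.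
[folklore] -/
lemma curvNormSqAdapted_eq_zero_of_isFlat (h : g.leviCivita.IsFlat) (x : M) (T : TangentSpace I x) :
    g.curvNormSqAdapted x T = 0 := by
  have h0 : ∀ X Y Z W : TangentSpace I x, g.curvatureForm g.leviCivita x X Y Z W = 0 := fun X Y Z W ↦ by
    simp [PseudoRiemannianMetric.curvatureForm, (g.leviCivita.isFlat_iff).1 h]
  simp [curvNormSqAdapted, h0]

end AdaptedNorm

end LorentzianMetric

/-! ### Local space-like leaves, their balls, measure and scale-critical energy -/

/-- A **local space-like leaf** of the Lorentzian manifold `(M, g)`: an open subset `U ⊆ ℝ³`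
(`domain : Opens E3`, a `3`-manifold modelled on `E3`), an *injective space-like immersion*
`φ = embed : U → M` (`IsSpacelikeImmersion`: `C^∞` with positive definite induced form `φ^* g`,
`Hypersurface.lean`; injectivity excludes multiply covered regions) and a *unit timelike normal
field* `ν = normal` along `φ` (`IsUnitNormal … (-1)`: `g(ν, dφ v) = 0`, `g(ν, ν) = −1`). Every
point of a space-like hypersurface — in particular of a leaf `Σ_t` of a foliation as in
Klainerman–Rodnianski–Szeftel, arXiv:1204.1767, Thm. 2.2 — has a neighbourhood of this form (a
chart), and all notions below are local. No time orientation is recorded: the induced metric, the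
square norm of the second fundamental form and the adapted curvature norm are invariant under
`ν ↦ −ν`. [cite: KlainermanRodnianskiSzeftel2015, Thm. 2.2 (space-like leaves `Σ_t`)] -/
structure SpacelikeLeaf (g : LorentzianMetric I ∞ M) where
  /-- The parameter domain, an open subset of `ℝ³`. -/
  domain : TopologicalSpace.Opens E3
  /-- The immersion `φ : U → M`. -/
  embed : domain → M
  /-- The unit timelike normal field `ν` along `φ`. -/
  normal : NormalField I embed
  /-- `φ` is a space-like immersion (`C^∞`, `φ^* g` positive definite). -/
  isSpacelikeImmersion : g.IsSpacelikeImmersion 𝓘(ℝ, E3) embed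
  /-- `φ` is injective. -/
  injective : Injective embed
  /-- `ν` is a unit normal of sign `−1`: orthogonal to `dφ(TU)` and `g(ν, ν) = −1`. -/
  isUnitNormal : g.IsUnitNormal 𝓘(ℝ, E3) embed normal (-1)

namespace SpacelikeLeaf

variable {g : LorentzianMetric I ∞ M} (L : SpacelikeLeaf g)

/-- The **induced Riemannian metric** `h = φ^* g` of the leaf, as a Mathlib Riemannian bundle
metric on `TU` (`PseudoRiemannianMetric.inducedRiemannianMetric`; smoothness of the pull-back by
`contMDiff_pullbackBilin_holds`). O'Neill 1983, Ch. 4, p. 97; Klainerman–Rodnianski–Szeftel,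
arXiv:1204.1767, §3.2 ("`g` is the induced metric on `Σ_t`").
[cite: KlainermanRodnianskiSzeftel2015, §3.2] -/
def riemannianMetric : ContMDiffRiemannianMetric 𝓘(ℝ, E3) ∞ E3 (TangentSpace 𝓘(ℝ, E3) : L.domain → Type _) :=
  g.inducedRiemannianMetric L.embed PseudoRiemannianMetric.contMDiff_pullbackBilin_holds
    L.isSpacelikeImmersion

/-- The induced metric `h = φ^* g` of the leaf as a (Riemannian) `PseudoRiemannianMetric` on `TU`,
so that the metric-contraction API (`normSq`, `edist`) applies
(`PseudoRiemannianMetric.inducedMetric`). O'Neill 1983, Ch. 4, p. 97.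
[cite: ONeill1983, Ch. 4, p. 97] -/
def metric : PseudoRiemannianMetric 𝓘(ℝ, E3) ∞ E3 (TangentSpace 𝓘(ℝ, E3) : L.domain → Type _) :=
  g.inducedMetric L.embed PseudoRiemannianMetric.contMDiff_pullbackBilin_holds L.isSpacelikeImmersion

/-- The induced metric of a leaf at `y` is `φ^* g` at `y`: `h_y(v, w) = g(dφ_y v, dφ_y w)`.
[folklore] -/
@[simp]
lemma metric_val (y : L.domain) (v w : TangentSpace 𝓘(ℝ, E3) y) :
    L.metric.val y v w = g.val (L.embed y) (mfderiv 𝓘(ℝ, E3) I L.embed y v)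
      (mfderiv 𝓘(ℝ, E3) I L.embed y w) :=
  rfl

/-- The induced metric of a space-like leaf is Riemannian. O'Neill 1983, Ch. 5, p. 142.
[cite: ONeill1983, Ch. 5, p. 142] -/
lemma isRiemannian_metric : L.metric.IsRiemannian :=
  PseudoRiemannianMetric.isRiemannian_ofRiemannian _

/-- The **geodesic (distance) ball** `B_r(y) = {z | d_h(y, z) < r}` of the leaf for its induced
Riemannian metric `h` (Riemannian distance `PseudoRiemannianMetric.edist`, O'Neill 1983, Ch. 5,
Def. 15), radius `r : ℝ` read in `ℝ≥0∞` (empty for `r ≤ 0`). Klainerman–Rodnianski–Szeftel,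
arXiv:1204.1767, Def. 2.1 ("`B_r(p)` the geodesic ball of center `p` and radius `r`").
[cite: KlainermanRodnianskiSzeftel2015, Def. 2.1] -/
def ball (y : L.domain) (r : ℝ) : Set L.domain :=
  {z | L.metric.edist L.isRiemannian_metric y z < ENNReal.ofReal r}

/-- Membership in a ball of a leaf. [folklore] -/
@[simp]
lemma mem_ball {y z : L.domain} {r : ℝ} :
    z ∈ L.ball y r ↔ L.metric.edist L.isRiemannian_metric y z < ENNReal.ofReal r :=
  Iff.rfl

/-- Balls of a leaf are monotone in the radius. [folklore] -/
lemma ball_mono (y : L.domain) {r r' : ℝ} (h : r ≤ r') : L.ball y r ⊆ L.ball y r' :=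
  fun _ hz ↦ lt_of_lt_of_le hz (ENNReal.ofReal_le_ofReal h)

/-- The centre belongs to every ball of positive radius. [folklore] -/
lemma mem_ball_self (y : L.domain) {r : ℝ} (hr : 0 < r) : y ∈ L.ball y r := by
  rw [mem_ball, PseudoRiemannianMetric.edist_self]
  exact ENNReal.ofReal_pos.2 hr

/-- The **Riemannian measure** `dvol_h` of the leaf (`riemannianMeasure` of `Volume.lean`: the
Euclidean-normalised `3`-dimensional Hausdorff measure of the length metric of `h`, i.e.
`√(det h_{ij}) dy` in charts). Klainerman–Rodnianski–Szeftel, arXiv:1204.1767, Def. 2.1 ("`|B_r|`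
the volume of `B_r` relative to the metric"). [cite: KlainermanRodnianskiSzeftel2015, Def. 2.1] -/
def measure : Measure L.domain :=
  riemannianMeasure L.riemannianMetric

variable [g.HasLeviCivita]

/-- **The scale-critical curvature energy** `r · ∫_{B_r(y)} |𝐑|²_ν dvol_h ∈ [0, ∞]` of the ball
`B_r(y)` of the leaf: the lower Lebesgue integral over the ball, for the Riemannian measure of the
induced metric, of the square norm `|𝐑|²_ν` of the space-time curvature in frames adapted to the
leaf normal (`LorentzianMetric.curvNormSqAdapted g (φ z) (ν z)`), times the radius. By
Klainerman–Rodnianski–Szeftel, arXiv:1204.1767, §2.3 (`‖R_λ‖_{L²(B^λ_{r₀})} = √λ ‖R‖_{L²(B_{r₀})}`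
under `𝐠_λ(t, x) = 𝐠(λt, λx)`) this product is invariant under rescaling, and `r ∫_{B_r} |𝐑|² ≤ ε²`
with `ε < ε₀` is (after rescaling the ball to unit size) the curvature hypothesis of their
small-data theorem, Thm. 2.6. [cite: KlainermanRodnianskiSzeftel2015, §2.3 and Thm. 2.6] -/
def curvatureEnergy (y : L.domain) (r : ℝ) : ℝ≥0∞ :=
  ENNReal.ofReal r * ∫⁻ z in L.ball y r, ENNReal.ofReal (g.curvNormSqAdapted (L.embed z) (L.normal z)) ∂L.measure

/-- The scale-critical energy is monotone in the radius (both factors are). [folklore] -/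
lemma curvatureEnergy_mono (y : L.domain) {r r' : ℝ} (h : r ≤ r') :
    L.curvatureEnergy y r ≤ L.curvatureEnergy y r' :=
  mul_le_mul' (ENNReal.ofReal_le_ofReal h) (lintegral_mono_set (L.ball_mono y h))

/-- For a flat metric every ball of every leaf has zero scale-critical energy. [folklore] -/
lemma curvatureEnergy_eq_zero_of_isFlat (h : g.leviCivita.IsFlat) (y : L.domain) (r : ℝ) :
    L.curvatureEnergy y r = 0 := by
  simp [curvatureEnergy, g.curvNormSqAdapted_eq_zero_of_isFlat h]

variable [FiniteDimensional ℝ E]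

/-- **Unit geometry control of the leaf at scale `Λ⁻¹` about the centre `y`, with non-collapsing
constant `v₀`** (HYPOTHESIS structure on a test leaf): `0 < Λ`, `0 < v₀`; the ball `B_{Λ⁻¹}(y)` is
contained in a compact subset of the leaf (so it is an honest geodesic ball of any space-like
hypersurface extending the local leaf, not truncated by the edge of the parameter domain, and
continuous densities are integrable on it); the second fundamental form `k = K_ν` of `φ`
(`secondFundamentalForm`, sign convention of `Hypersurface.lean`) satisfies `|k|²_h ≤ Λ²` on the
leaf (`PseudoRiemannianMetric.normSq` for the induced metric); and the **volume radius of the leaf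
at `y` on scales `≤ Λ⁻¹` is at least `v₀`**: `|B_ρ(y)|_h ≥ v₀ ρ³` for `0 < ρ ≤ Λ⁻¹`
(Klainerman–Rodnianski–Szeftel, arXiv:1204.1767, Def. 2.1, `r_vol(p, r) = inf_{r' ≤ r} |B_{r'}(p)|/r'³`).
These are the pointwise/unit-scale forms of the hypotheses `‖k‖_{L²} + ‖∇k‖_{L²} ≤ ε`,
`r_vol(Σ₀, 1) ≥ 1/2` of ibid., Thm. 2.10, under which the curvature energy alone decides
continuation; a lapse bound concerns a foliation, not a single leaf, and is not recorded (module
docstring). All three conditions are invariant under the rescaling `(g, Λ, v₀) ↦ (μ² g, Λ/μ, v₀)`.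
[cite: KlainermanRodnianskiSzeftel2015, Def. 2.1 and Thm. 2.10] -/
structure IsControlled (L : SpacelikeLeaf g) (y : L.domain) (Λ v₀ : ℝ) : Prop where
  /-- The scale parameter is positive. -/
  pos : 0 < Λ
  /-- The non-collapsing constant is positive. -/
  pos_volume : 0 < v₀
  /-- The ball of radius `Λ⁻¹` about the centre is relatively compact in the leaf. -/
  exists_isCompact_ball_subset : ∃ K : Set L.domain, IsCompact K ∧ L.ball y Λ⁻¹ ⊆ K
  /-- `|k|²_h ≤ Λ²` on the leaf. -/
  normSq_secondFundamentalForm_le : ∀ z : L.domain,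
    L.metric.normSq z (g.secondFundamentalForm 𝓘(ℝ, E3) L.embed L.normal z) ≤ Λ ^ 2
  /-- Volume radius at the centre on scales `≤ Λ⁻¹`: `v₀ ρ³ ≤ |B_ρ(y)|` for `0 < ρ ≤ Λ⁻¹`. -/
  le_measure_ball : ∀ ρ : ℝ, 0 < ρ → ρ ≤ Λ⁻¹ → ENNReal.ofReal (v₀ * ρ ^ 3) ≤ L.measure (L.ball y ρ)

/-- Geometry control is monotone in the constants: control at scale `Λ⁻¹` with constant `v₀`
implies control at every smaller scale `Λ'⁻¹ ≤ Λ⁻¹` with every smaller constant `0 < v₀' ≤ v₀`.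
[folklore] -/
lemma IsControlled.mono {L : SpacelikeLeaf g} {y : L.domain} {Λ Λ' v₀ v₀' : ℝ}
    (h : L.IsControlled y Λ v₀) (hΛ : Λ ≤ Λ') (hv : v₀' ≤ v₀) (hv₀' : 0 < v₀') :
    L.IsControlled y Λ' v₀' := by
  have hinv : Λ'⁻¹ ≤ Λ⁻¹ := inv_anti₀ h.pos hΛ
  refine ⟨h.pos.trans_le hΛ, hv₀', ?_, fun z ↦ ?_, fun ρ hρ hρΛ ↦ ?_⟩
  · obtain ⟨K, hK, hsub⟩ := h.exists_isCompact_ball_subset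
    exact ⟨K, hK, (L.ball_mono y hinv).trans hsub⟩
  · exact (h.normSq_secondFundamentalForm_le z).trans (pow_le_pow_left₀ h.pos.le hΛ 2)
  · refine le_trans (ENNReal.ofReal_le_ofReal ?_) (h.le_measure_ball ρ hρ (hρΛ.trans hinv))
    exact mul_le_mul_of_nonneg_right hv (by positivity)

end SpacelikeLeaf

/-! ### Scale-critical concentration at the end of a curve -/

namespace LorentzianMetric

variable [FiniteDimensional ℝ E] (g : LorentzianMetric I ∞ M) [g.HasLeviCivita]

/-- **Scale-critical curvature concentration at the (future) end of the curve `γ` with parameter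
set `dom`**, at geometry-control scale `Λ⁻¹`, non-collapsing constant `v₀` and threshold `ε₀`:
`0 < ε₀`, and for every `t₀ ∈ dom`, every open `U ⊆ M` containing the tail
`γ({t ∈ dom | t₀ ≤ t})` and every `δ > 0` there are a local space-like leaf `L` (`SpacelikeLeaf`)
with unit geometry control at scale `Λ⁻¹` about a point `y` (`SpacelikeLeaf.IsControlled`), and a
radius `0 < r < δ`, such that the geodesic ball `B_r(y)` of the leaf is mapped into `U` and its
scale-critical curvature energy is at least `ε₀`:
`ε₀ ≤ r · ∫_{B_r(y)} |𝐑|²_ν dvol_h` (`SpacelikeLeaf.curvatureEnergy`). Equivalently there are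
controlled leaves `L_n`, centres `y_n` converging to the end of `γ` (eventually inside every
neighbourhood of every tail) and radii `r_n → 0` with `r_n ∫_{B_{r_n}(y_n)} |𝐑|² ≥ ε₀` — the
scale-invariant curvature energy of Klainerman–Rodnianski–Szeftel (arXiv:1204.1767, §2.3) stays
above the small-data threshold of their Thm. 2.6 at arbitrarily small scales near the end, on
leaves satisfying the unit-scale geometry hypotheses of Thm. 2.10; its negation — energy `< ε₀` on
all small balls near the end of all controlled leaves — is the smallness regime of that theorem.
The quantification over all controlled leaves makes the notion independent of any choice of
foliation (module docstring). Monotone in the constants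
(`ScaleCriticalConcentrationAt.mono`); never satisfied by a flat metric
(`not_scaleCriticalConcentrationAt_of_isFlat`). This predicate is the route's rendering
(`FinalStateConjecture/CurvatureOrSymmetry`, crux `ScaleCriticalUpgrade`) of "curvature
concentrates at the ideal end of `γ`" in the scale-critical norm of the cited theorem; it is a
definition, not an assertion. [cite: KlainermanRodnianskiSzeftel2015, §2.3, Thm. 2.6 and Thm. 2.10] -/
def ScaleCriticalConcentrationAt (γ : ℝ → M) (dom : Set ℝ) (Λ v₀ ε₀ : ℝ) : Prop :=
  0 < ε₀ ∧ ∀ t₀ ∈ dom, ∀ U : Set M, IsOpen U → γ '' {t ∈ dom | t₀ ≤ t} ⊆ U → ∀ δ : ℝ, 0 < δ →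
    ∃ (L : SpacelikeLeaf g) (y : L.domain) (r : ℝ), 0 < r ∧ r < δ ∧ L.IsControlled y Λ v₀ ∧
      L.embed '' L.ball y r ⊆ U ∧ ENNReal.ofReal ε₀ ≤ L.curvatureEnergy y r

variable {g}

/-- The threshold of a scale-critical concentration is positive. [folklore] -/
lemma ScaleCriticalConcentrationAt.pos {γ : ℝ → M} {dom : Set ℝ} {Λ v₀ ε₀ : ℝ}
    (h : g.ScaleCriticalConcentrationAt γ dom Λ v₀ ε₀) : 0 < ε₀ :=
  h.1

/-- **Monotonicity in the constants.** Concentration with control scale `Λ⁻¹`, non-collapsing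
constant `v₀` and threshold `ε₀` implies concentration for every `Λ' ≥ Λ`, `0 < v₀' ≤ v₀` and
`0 < ε₀' ≤ ε₀` (more leaves are admissible and less energy is demanded). [folklore] -/
lemma ScaleCriticalConcentrationAt.mono {γ : ℝ → M} {dom : Set ℝ} {Λ Λ' v₀ v₀' ε₀ ε₀' : ℝ}
    (h : g.ScaleCriticalConcentrationAt γ dom Λ v₀ ε₀) (hΛ : Λ ≤ Λ') (hv : v₀' ≤ v₀)
    (hv₀' : 0 < v₀') (hε : ε₀' ≤ ε₀) (hε₀' : 0 < ε₀') :
    g.ScaleCriticalConcentrationAt γ dom Λ' v₀' ε₀' := by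
  refine ⟨hε₀', fun t₀ ht₀ U hU hsub δ hδ ↦ ?_⟩
  obtain ⟨L, y, r, hr, hrδ, hc, hball, hE⟩ := h.2 t₀ ht₀ U hU hsub δ hδ
  exact ⟨L, y, r, hr, hrδ, hc.mono hΛ hv hv₀', hball, (ENNReal.ofReal_le_ofReal hε).trans hE⟩

/-- **Concentration is a property of the end of `γ`**: it only depends on the tails of the
parameter set — if it holds for a cofinal subset `dom' ⊆ dom` (every `t ∈ dom` is `≤` some
`t' ∈ dom'`, e.g. `dom' = dom ∩ [t₁, ∞)` or a sequence increasing to `sup dom`), it holds for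
`dom`. [folklore] -/
lemma ScaleCriticalConcentrationAt.of_cofinal {γ : ℝ → M} {dom dom' : Set ℝ} {Λ v₀ ε₀ : ℝ}
    (h : g.ScaleCriticalConcentrationAt γ dom' Λ v₀ ε₀) (hsub : dom' ⊆ dom)
    (hcof : ∀ t ∈ dom, ∃ t' ∈ dom', t ≤ t') :
    g.ScaleCriticalConcentrationAt γ dom Λ v₀ ε₀ := by
  refine ⟨h.1, fun t₀ ht₀ U hU hU' δ hδ ↦ ?_⟩
  obtain ⟨t₁, ht₁, h01⟩ := hcof t₀ ht₀
  refine h.2 t₁ ht₁ U hU ?_ δ hδ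
  rintro _ ⟨t, ⟨ht, ht₁t⟩, rfl⟩
  exact hU' ⟨t, ⟨hsub ht, h01.trans ht₁t⟩, rfl⟩

/-- **A flat space-time has no scale-critical curvature concentration** along any curve with
nonempty parameter set: all energies vanish (`SpacelikeLeaf.curvatureEnergy_eq_zero_of_isFlat`)
while `ε₀ > 0`. In particular Minkowski space (`Minkowski.riemann_smoothMetric_eq_zero`,
`MinkowskiFlat.lean`) has none: the predicate is a genuine condition. [folklore] -/
theorem not_scaleCriticalConcentrationAt_of_isFlat (hflat : g.leviCivita.IsFlat) {γ : ℝ → M}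
    {dom : Set ℝ} (hdom : dom.Nonempty) (Λ v₀ ε₀ : ℝ) :
    ¬ g.ScaleCriticalConcentrationAt γ dom Λ v₀ ε₀ := by
  rintro ⟨hε₀, h⟩
  obtain ⟨t₀, ht₀⟩ := hdom
  obtain ⟨L, y, r, -, -, -, -, hE⟩ := h t₀ ht₀ univ isOpen_univ (subset_univ _) 1 one_pos
  rw [L.curvatureEnergy_eq_zero_of_isFlat hflat, nonpos_iff_eq_zero, ENNReal.ofReal_eq_zero] at hE
  exact (not_le.2 hε₀) hE

end LorentzianMetric

/-! ### Cauchy developments -/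

namespace CauchyDevelopment

variable {X : Type u} [TopologicalSpace X] [ChartedSpace E3 X] [IsManifold (𝓡 3) ∞ X]
  [ConnectedSpace X] {D : InitialDataSet (𝓡 3) X}

/-- **Scale-critical curvature concentration at the end of the curve `γ` (parameter set `dom`) in
the Cauchy development `𝒟 = (M, g, τ, ι, ν)`** of `3`-dimensional initial data:
`LorentzianMetric.ScaleCriticalConcentrationAt` for the space-time metric of `𝒟` — for every
neighbourhood of every tail of `γ` and every scale `δ > 0` some local space-like leaf with unit
geometry control at scale `Λ⁻¹` (second fundamental form `|k|²_h ≤ Λ²`, volume radius `≥ v₀` on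
scales `≤ Λ⁻¹`, honest ball of radius `Λ⁻¹`) carries a geodesic ball of radius `< δ` inside the
neighbourhood with `r ∫_{B_r} |𝐑|²_ν dvol ≥ ε₀ > 0` (Klainerman–Rodnianski–Szeftel,
arXiv:1204.1767, §2.3 and Thm. 2.6: the scale-invariant curvature energy above the small-data
threshold). As in `CauchyDevelopment.FirstNakedPoint` the standing Levi-Civita hypothesis
`[𝒟.metric.HasLeviCivita]` is bound inside. Intended use (route
`FinalStateConjecture/CurvatureOrSymmetry`, crux `ScaleCriticalUpgrade`): `γ` a visible
future-incomplete null geodesic of a maximal vacuum Cauchy development with affine domain `dom`.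
[cite: KlainermanRodnianskiSzeftel2015, §2.3, Thm. 2.6 and Thm. 2.10] -/
def ScaleCriticalConcentrationAt (𝒟 : CauchyDevelopment D) (γ : ℝ → 𝒟.carrier) (dom : Set ℝ)
    (Λ v₀ ε₀ : ℝ) : Prop :=
  ∀ [𝒟.metric.HasLeviCivita], 𝒟.metric.ScaleCriticalConcentrationAt γ dom Λ v₀ ε₀

/-- Unfolding lemma: granted the Levi-Civita connection, `𝒟.ScaleCriticalConcentrationAt` is
`LorentzianMetric.ScaleCriticalConcentrationAt` for the metric of `𝒟`. [folklore] -/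
lemma scaleCriticalConcentrationAt_iff (𝒟 : CauchyDevelopment D) [𝒟.metric.HasLeviCivita]
    (γ : ℝ → 𝒟.carrier) (dom : Set ℝ) (Λ v₀ ε₀ : ℝ) :
    𝒟.ScaleCriticalConcentrationAt γ dom Λ v₀ ε₀ ↔
      𝒟.metric.ScaleCriticalConcentrationAt γ dom Λ v₀ ε₀ :=
  ⟨fun h ↦ h, fun h _ ↦ h⟩

/-- The threshold of a scale-critical concentration in a Cauchy development is positive (granted
the Levi-Civita connection). [folklore] -/
lemma ScaleCriticalConcentrationAt.pos {𝒟 : CauchyDevelopment D} [𝒟.metric.HasLeviCivita]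
    {γ : ℝ → 𝒟.carrier} {dom : Set ℝ} {Λ v₀ ε₀ : ℝ}
    (h : 𝒟.ScaleCriticalConcentrationAt γ dom Λ v₀ ε₀) : 0 < ε₀ :=
  ((scaleCriticalConcentrationAt_iff 𝒟 γ dom Λ v₀ ε₀).1 h).pos

end CauchyDevelopment

end Literature.Geometry.Lorentzian

end
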